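import Summits.Ventures.PercRepro.PurePairGraphTablesPR
import Summits.Ventures.PercRepro.PurePairGraphEvents
import Summits.Ventures.PercRepro.PurePairGraphCells
import Summits.Ventures.PercRepro.StarGadgetPurePairNonneg
import Summits.Ventures.PercRepro.StarGadgetGraphDelta

/-!
# The pure-pair gadget — `Δ = G` and the D-free inequality (modules 6b + 8)

PART A: in a cell, «in mode `μ` and the H-event holds» is the weight `Wfun` of the fact vector
(`event_eq_Wfun`), hence the cell sums (`cellsum_eq`); the impossible cells vanish; the weight `w`
splits over the modes (`w_eq_sum_wmode`, `sum_w_mk`); the mode sums (`part_*`) and the sums over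
all branch configurations for `c – x` closed / open (`sumg_*`).

PART B (**the graph half of the pure-pair theorem**): the (★)-slack of `x ~ c` + `p, q, r, s` hubs +
`n` pure pairs, in the H-graph form of `dFreeIneq_iff_hGraph`, equals mine-3's `G p q r s n`
(`purePair_delta`); with `G_nonneg` the D-free inequality holds on every such gadget
(`purePair_dFreeIneq`).
-/

namespace PercRepro.PurePairGraph

open MultiGraph Finset Classical StarGadgetGraph

variable {p q r s n : ℕ}

/-- In a cell, «in mode `μ` and the H-event holds» is the weight `Wfun` of the fact vector. -/
theorem event_eq_Wfun {k : ℕ} (μ : Mode) (X : Option (Fin 3)) (src dst : Fin 4)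
    (pairs : Fin k → Option (Fin 4 × Fin 4)) (g : Fin 1 → Bool) (σ : BrConfig p q r s n)
    (hlive : ∀ i j, i ≠ j → nx X μ i = true → nx X μ j = true →
      T2 true (cxbit g) μ i j = false → ∃ l, pairs l = some (i, j) ∨ pairs l = some (j, i))
    (hmode : InMode μ (mk g σ) ↔ (hasW pairs → factOf (bWpred μ) σ)) :
    (if InMode μ (mk g σ) ∧ (purePairGadget p q r s n).HConnAvoid (mk g σ) (vm 2)
        (Xset (mk g σ) X) (cen src) (cen dst) then (1 : ℤ) else 0) =
      Wfun true (cxbit g) μ X pairs src dst (tvec μ X pairs σ) := by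
  unfold Wfun
  have hw : wcond pairs (tvec μ X pairs σ) ↔ InMode μ (mk g σ) := by
    rw [hmode]
    unfold wcond hasW tvec
    constructor
    · rintro h ⟨l, hl⟩
      have := h l hl
      rw [decide_eq_true_iff] at this
      unfold famPred at this
      rw [hl] at this
      exact this
    · intro h l hl
      rw [decide_eq_true_iff]
      unfold famPred
      rw [hl]
      exact h ⟨l, hl⟩
  by_cases hM : InMode μ (mk g σ)
  · have hβ : cxOpen (mk g σ) ↔ cxbit g = true := cxOpen_mk_iff g σ
    have hd : ∀ i j, i ≠ j → nx X μ i = true → nx X μ j = true →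
        T2 true (cxbit g) μ i j = false →
        ((∃ b : Br p q r s n, bDpred μ X i j (brType b) (fun e => (mk g σ) (.inr ⟨b, e⟩))) ↔
          dmat pairs (tvec μ X pairs σ) i j = true) := by
      intro i j hij hi hj hT
      simp only [brState_mk]
      unfold dmat tvec
      rw [decide_eq_true_iff]
      constructor
      · intro hD
        obtain ⟨l, hl⟩ := hlive i j hij hi hj hT
        refine ⟨l, hl, ?_⟩
        rw [decide_eq_true_iff]
        unfold famPred factOf
        rcases hl with hl | hl <;> rw [hl]
        · exact hD
        · obtain ⟨b, hb⟩ := hD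
          exact ⟨b, (bDpred_comm μ X i j _ _).1 hb⟩
      · rintro ⟨l, hl, hf⟩
        rw [decide_eq_true_iff] at hf
        unfold famPred factOf at hf
        rcases hl with hl | hl <;> rw [hl] at hf
        · exact hf
        · obtain ⟨b, hb⟩ := hf
          exact ⟨b, (bDpred_comm μ X j i _ _).1 hb⟩
    have hR := hConnAvoid_cen_iff_reach4 hM hβ X (dmat pairs (tvec μ X pairs σ)) hd src dst
    have hw' : wcond pairs (tvec μ X pairs σ) := hw.2 hM
    by_cases hE : reach4 (cellMat true (cxbit g) μ X (dmat pairs (tvec μ X pairs σ))) src dst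
    · rw [if_pos ⟨hM, hR.2 hE⟩, if_pos ⟨hw', hE⟩]
    · rw [if_neg (fun h => hE (hR.1 h.2)), if_neg (fun h => hE h.2)]
  · have hw' : ¬ wcond pairs (tvec μ X pairs σ) := fun h => hM (hw.1 h)
    rw [if_neg (fun h => hM h.1), if_neg (fun h => hw' h.1)]

/-- **The cell sum** is the weighted count of `cell_eq`. -/
theorem cellsum_eq {k : ℕ} (μ : Mode) (X : Option (Fin 3)) (src dst : Fin 4)
    (pairs : Fin k → Option (Fin 4 × Fin 4)) (g : Fin 1 → Bool)
    (hlive : ∀ i j, i ≠ j → nx X μ i = true → nx X μ j = true →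
      T2 true (cxbit g) μ i j = false → ∃ l, pairs l = some (i, j) ∨ pairs l = some (j, i))
    (hmode : ∀ σ : BrConfig p q r s n, allowed μ σ →
      (InMode μ (mk g σ) ↔ (hasW pairs → factOf (bWpred μ) σ))) :
    (∑ σ ∈ univ.filter (allowed μ : BrConfig p q r s n → Prop),
      if InMode μ (mk g σ) ∧ (purePairGadget p q r s n).HConnAvoid (mk g σ) (vm 2)
        (Xset (mk g σ) X) (cen src) (cen dst) then (1 : ℤ) else 0) =
      ∑ σ ∈ univ.filter (allowed μ : BrConfig p q r s n → Prop),
        Wfun true (cxbit g) μ X pairs src dst (tvec μ X pairs σ) := by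
  refine Finset.sum_congr rfl fun σ hσ => ?_
  rw [Finset.mem_filter] at hσ
  exact event_eq_Wfun μ X src dst pairs g σ hlive (hmode σ hσ.2)

/-- A cell that is impossible (mode `μ ≠ M` with `c – x` open) contributes nothing. -/
theorem cellsum_eq_zero_of_open {μ : Mode} (hμ : μ ≠ some 2) (X : Option (Fin 3)) (src dst : Fin 4)
    (g : Fin 1 → Bool) (hg : cxbit g = true) :
    (∑ σ ∈ univ.filter (allowed μ : BrConfig p q r s n → Prop),
      if InMode μ (mk g σ) ∧ (purePairGadget p q r s n).HConnAvoid (mk g σ) (vm 2)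
        (Xset (mk g σ) X) (cen src) (cen dst) then (1 : ℤ) else 0) = 0 := by
  refine Finset.sum_eq_zero fun σ _ => ?_
  have hM : ¬ InMode μ (mk g σ) := by
    rintro ⟨-, hAtt⟩
    have : Att (mk g σ) 2 := Or.inl ⟨rfl, Or.inl ((cxOpen_mk_iff g σ).2 hg)⟩
    exact hμ ((hAtt 2).1 this)
  simp [hM]

/-! ### The total weight splits over the modes -/

/-- The three H-events of the (★)-slack. -/
def ev (X : Option (Fin 3)) (src dst : Fin 4) (ω : Config (PE p q r s n)) : Prop :=
  (purePairGadget p q r s n).HConnAvoid ω (vm 2) (Xset ω X) (cen src) (cen dst)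

/-- The weight of a configuration: `[bot ∧ o1] + [bot ∧ o2] − [bot ∧ bad]`. -/
noncomputable def w (ω : Config (PE p q r s n)) : ℤ :=
  (if (purePairGadget p q r s n).IsBot ω (vm 0) (vm 1) (vm 2) ∧ ev (some 1) 2 0 ω then 1 else 0) +
    (if (purePairGadget p q r s n).IsBot ω (vm 0) (vm 1) (vm 2) ∧ ev (some 0) 2 1 ω then 1 else 0) -
      (if (purePairGadget p q r s n).IsBot ω (vm 0) (vm 1) (vm 2) ∧ ev none 0 1 ω then 1 else 0)

/-- The weight of a mode. -/
noncomputable def wmode (μ : Mode) (ω : Config (PE p q r s n)) : ℤ :=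
  (if InMode μ ω ∧ ev (some 1) 2 0 ω then 1 else 0) +
    (if InMode μ ω ∧ ev (some 0) 2 1 ω then 1 else 0) -
      (if InMode μ ω ∧ ev none 0 1 ω then 1 else 0)

/-- The weight is the sum of the mode weights. -/
theorem w_eq_sum_wmode (ω : Config (PE p q r s n)) : w ω = ∑ μ : Mode, wmode μ ω := by
  unfold w wmode
  rw [Finset.sum_sub_distrib, Finset.sum_add_distrib]
  rw [sum_modes_indicator, sum_modes_indicator, sum_modes_indicator]

/-- The sum of a mode weight over all branch configurations is its sum over the allowed ones. -/
theorem sum_wmode_eq_filter (μ : Mode) (g : Fin 1 → Bool) :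
    (∑ σ : BrConfig p q r s n, wmode μ (mk g σ)) =
      ∑ σ ∈ univ.filter (allowed μ : BrConfig p q r s n → Prop), wmode μ (mk g σ) := by
  rw [Finset.sum_filter]
  refine Finset.sum_congr rfl fun σ _ => ?_
  by_cases hA : allowed μ σ
  · rw [if_pos hA]
  · have hM : ¬ InMode μ (mk g σ) := fun h => hA (allowed_of_inMode h)
    rw [if_neg hA]
    unfold wmode
    rw [if_neg (fun h => hM h.1), if_neg (fun h => hM h.1), if_neg (fun h => hM h.1)]
    norm_num

/-- The sum of the weight over the branch configurations splits over the modes. -/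
theorem sum_w_mk (g : Fin 1 → Bool) :
    ∑ σ : BrConfig p q r s n, w (mk g σ) =
      ∑ μ : Mode, ∑ σ ∈ univ.filter (allowed μ : BrConfig p q r s n → Prop), wmode μ (mk g σ) := by
  simp_rw [w_eq_sum_wmode]
  rw [Finset.sum_comm]
  exact Finset.sum_congr rfl fun μ _ => sum_wmode_eq_filter μ g

/-- Mode R with `c – x` closed: the three cells. -/
theorem part_R_closed (p q r s n : ℕ) (g : Fin 1 → Bool) (hg : cxbit g = false) :
    ∑ σ ∈ univ.filter (allowed none : BrConfig p q r s n → Prop), wmode none (mk g σ) =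
      (1) * (((4:ℤ)) ^ p * ((4:ℤ)) ^ q * ((4:ℤ)) ^ r * ((5:ℤ)) ^ s * ((16:ℤ)) ^ n) + (-1) * (((4:ℤ)) ^ p * ((2:ℤ)) ^ q * ((4:ℤ)) ^ r * ((3:ℤ)) ^ s * ((16:ℤ)) ^ n) + (1) * (((4:ℤ)) ^ p * ((4:ℤ)) ^ q * ((4:ℤ)) ^ r * ((5:ℤ)) ^ s * ((16:ℤ)) ^ n) + (-1) * (((4:ℤ)) ^ p * ((4:ℤ)) ^ q * ((2:ℤ)) ^ r * ((3:ℤ)) ^ s * ((16:ℤ)) ^ n) + (-1) * (((4:ℤ)) ^ p * ((4:ℤ)) ^ q * ((4:ℤ)) ^ r * ((5:ℤ)) ^ s * ((16:ℤ)) ^ n) + (1) * (((4:ℤ)) ^ p * ((4:ℤ)) ^ q * ((2:ℤ)) ^ r * ((3:ℤ)) ^ s * ((16:ℤ)) ^ n) + (1) * (((4:ℤ)) ^ p * ((2:ℤ)) ^ q * ((4:ℤ)) ^ r * ((3:ℤ)) ^ s * ((16:ℤ)) ^ n) + (-1) * (((4:ℤ)) ^ p * ((2:ℤ)) ^ q *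 ((2:ℤ)) ^ r * ((2:ℤ)) ^ s * ((16:ℤ)) ^ n) := by
  unfold wmode ev
  rw [Finset.sum_sub_distrib, Finset.sum_add_distrib]
  rw [cellsum_eq none (some 1) 2 0 ![some (0, 2), some (0, 3)] g (by rw [hg]; decide)
      (fun σ hA => by rw [inMode_none_mk_iff hA, hg, imp_not_hasW_iff (by decide)]; simp), hg, cell_R_closed_o1, cellsum_eq none (some 0) 2 1 ![some (1, 2), some (1, 3)] g (by rw [hg]; decide)
      (fun σ hA => by rw [inMode_none_mk_iff hA, hg, imp_not_hasW_iff (by decide)]; simp), hg, cell_R_closed_o2, cellsum_eq none none 0 1 ![some (0, 1), some (0, 2), some (0, 3), some (1, 2), some (1, 3)] g (by rw [hg]; decide)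
      (fun σ hA => by rw [inMode_none_mk_iff hA, hg, imp_not_hasW_iff (by decide)]; simp), hg, cell_R_closed_bad]
  ring

/-- Mode K with `c – x` closed: the three cells. -/
theorem part_K_closed (p q r s n : ℕ) (g : Fin 1 → Bool) (hg : cxbit g = false) :
    ∑ σ ∈ univ.filter (allowed (some 0) : BrConfig p q r s n → Prop), wmode (some 0) (mk g σ) =
      (1) * (((5:ℤ)) ^ p * ((5:ℤ)) ^ q * ((4:ℤ)) ^ r * ((6:ℤ)) ^ s * ((16:ℤ)) ^ n) + (-1) * (((4:ℤ)) ^ p * ((4:ℤ)) ^ q * ((4:ℤ)) ^ r * ((5:ℤ)) ^ s * ((16:ℤ)) ^ n) + (1) * (((5:ℤ)) ^ p * ((5:ℤ)) ^ q * ((4:ℤ)) ^ r * ((6:ℤ)) ^ s * ((16:ℤ)) ^ n) + (-1) * (((4:ℤ)) ^ p * ((4:ℤ)) ^ q * ((4:ℤ)) ^ r * ((5:ℤ)) ^ s * ((16:ℤ)) ^ n) + (-1) * (((5:ℤ)) ^ p * ((5:ℤ)) ^ q * ((3:ℤ)) ^ r * ((5:ℤ)) ^ s * ((16:ℤ)) ^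 n) + (1) * (((4:ℤ)) ^ p * ((4:ℤ)) ^ q * ((3:ℤ)) ^ r * ((4:ℤ)) ^ s * ((16:ℤ)) ^ n) + (-1) * (((5:ℤ)) ^ p * ((5:ℤ)) ^ q * ((4:ℤ)) ^ r * ((6:ℤ)) ^ s * ((16:ℤ)) ^ n) + (1) * (((4:ℤ)) ^ p * ((4:ℤ)) ^ q * ((4:ℤ)) ^ r * ((5:ℤ)) ^ s * ((16:ℤ)) ^ n) + (1) * (((5:ℤ)) ^ p * ((5:ℤ)) ^ q * ((2:ℤ)) ^ r * ((4:ℤ)) ^ s * ((16:ℤ)) ^ n) + (-1) * (((4:ℤ)) ^ p * ((4:ℤ)) ^ q * ((2:ℤ)) ^ r * ((3:ℤ)) ^ s * ((16:ℤ)) ^ n) := by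
  unfold wmode ev
  rw [Finset.sum_sub_distrib, Finset.sum_add_distrib]
  rw [cellsum_eq (some 0) (some 1) 2 0 ![some (0, 2), none] g (by rw [hg]; decide)
      (fun σ hA => by rw [inMode_someKL_mk_iff (by decide) hA, hg, imp_hasW_iff (by decide)]; simp), hg, cell_K_closed_o1, cellsum_eq (some 0) (some 0) 2 1 ![some (1, 2), none] g (by rw [hg]; decide)
      (fun σ hA => by rw [inMode_someKL_mk_iff (by decide) hA, hg, imp_hasW_iff (by decide)]; simp), hg, cell_K_closed_o2, cellsum_eq (some 0) none 0 1 ![some (0, 1), some (0, 2), some (1, 2), some (1, 3), none] g (by rw [hg]; decide)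
      (fun σ hA => by rw [inMode_someKL_mk_iff (by decide) hA, hg, imp_hasW_iff (by decide)]; simp), hg, cell_K_closed_bad]
  ring

/-- Mode L with `c – x` closed: the three cells. -/
theorem part_L_closed (p q r s n : ℕ) (g : Fin 1 → Bool) (hg : cxbit g = false) :
    ∑ σ ∈ univ.filter (allowed (some 1) : BrConfig p q r s n → Prop), wmode (some 1) (mk g σ) =
      (1) * (((5:ℤ)) ^ p * ((4:ℤ)) ^ q * ((5:ℤ)) ^ r * ((6:ℤ)) ^ s * ((16:ℤ)) ^ n) + (-1) * (((4:ℤ)) ^ p * ((4:ℤ)) ^ q * ((4:ℤ)) ^ r * ((5:ℤ)) ^ s * ((16:ℤ)) ^ n) + (-1) * (((5:ℤ)) ^ p * ((3:ℤ)) ^ q * ((5:ℤ)) ^ r * ((5:ℤ)) ^ s * ((16:ℤ)) ^ n) + (1) * (((4:ℤ)) ^ p * ((3:ℤ)) ^ q * ((4:ℤ)) ^ r * ((4:ℤ)) ^ s * ((16:ℤ)) ^ n) + (1) * (((5:ℤ)) ^ p * ((4:ℤ)) ^ q * ((5:ℤ)) ^ r * ((6:ℤ)) ^ s * ((16:ℤ))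 ^ n) + (-1) * (((4:ℤ)) ^ p * ((4:ℤ)) ^ q * ((4:ℤ)) ^ r * ((5:ℤ)) ^ s * ((16:ℤ)) ^ n) + (-1) * (((5:ℤ)) ^ p * ((4:ℤ)) ^ q * ((5:ℤ)) ^ r * ((6:ℤ)) ^ s * ((16:ℤ)) ^ n) + (1) * (((4:ℤ)) ^ p * ((4:ℤ)) ^ q * ((4:ℤ)) ^ r * ((5:ℤ)) ^ s * ((16:ℤ)) ^ n) + (1) * (((5:ℤ)) ^ p * ((2:ℤ)) ^ q * ((5:ℤ)) ^ r * ((4:ℤ)) ^ s * ((16:ℤ)) ^ n) + (-1) * (((4:ℤ)) ^ p * ((2:ℤ)) ^ q * ((4:ℤ)) ^ r * ((3:ℤ)) ^ s * ((16:ℤ)) ^ n) := by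
  unfold wmode ev
  rw [Finset.sum_sub_distrib, Finset.sum_add_distrib]
  rw [cellsum_eq (some 1) (some 1) 2 0 ![some (0, 2), none] g (by rw [hg]; decide)
      (fun σ hA => by rw [inMode_someKL_mk_iff (by decide) hA, hg, imp_hasW_iff (by decide)]; simp), hg, cell_L_closed_o1, cellsum_eq (some 1) (some 0) 2 1 ![some (1, 2), none] g (by rw [hg]; decide)
      (fun σ hA => by rw [inMode_someKL_mk_iff (by decide) hA, hg, imp_hasW_iff (by decide)]; simp), hg, cell_L_closed_o2, cellsum_eq (some 1) none 0 1 ![some (0, 1), some (0, 2), some (0, 3), some (1, 2), none] g (by rw [hg]; decide)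
      (fun σ hA => by rw [inMode_someKL_mk_iff (by decide) hA, hg, imp_hasW_iff (by decide)]; simp), hg, cell_L_closed_bad]
  ring

/-- Mode M with `c – x` closed: the three cells. -/
theorem part_M_closed (p q r s n : ℕ) (g : Fin 1 → Bool) (hg : cxbit g = false) :
    ∑ σ ∈ univ.filter (allowed (some 2) : BrConfig p q r s n → Prop), wmode (some 2) (mk g σ) =
      (1) * (((4:ℤ)) ^ p * ((5:ℤ)) ^ q * ((5:ℤ)) ^ r * ((6:ℤ)) ^ s * ((32:ℤ)) ^ n) + (-1) * (((4:ℤ)) ^ p * ((4:ℤ)) ^ q * ((4:ℤ)) ^ r * ((5:ℤ)) ^ s * ((16:ℤ)) ^ n) + (-1) * (((3:ℤ)) ^ p * ((2:ℤ)) ^ q * ((5:ℤ)) ^ r * ((3:ℤ)) ^ s * ((32:ℤ)) ^ n) + (1) * (((3:ℤ)) ^ p * ((1:ℤ)) ^ q * ((4:ℤ)) ^ r * ((2:ℤ)) ^ s * ((16:ℤ)) ^ n) + (1) * (((4:ℤ)) ^ p * ((5:ℤ)) ^ q * ((5:ℤ)) ^ r * ((6:ℤ)) ^ s * ((32:ℤ))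 ^ n) + (-1) * (((4:ℤ)) ^ p * ((4:ℤ)) ^ q * ((4:ℤ)) ^ r * ((5:ℤ)) ^ s * ((16:ℤ)) ^ n) + (-1) * (((3:ℤ)) ^ p * ((5:ℤ)) ^ q * ((2:ℤ)) ^ r * ((3:ℤ)) ^ s * ((32:ℤ)) ^ n) + (1) * (((3:ℤ)) ^ p * ((4:ℤ)) ^ q * ((1:ℤ)) ^ r * ((2:ℤ)) ^ s * ((16:ℤ)) ^ n) + (-1) * (((4:ℤ)) ^ p * ((5:ℤ)) ^ q * ((5:ℤ)) ^ r * ((6:ℤ)) ^ s * ((32:ℤ)) ^ n) + (1) * (((4:ℤ)) ^ p * ((4:ℤ)) ^ q * ((4:ℤ)) ^ r * ((5:ℤ)) ^ s * ((16:ℤ)) ^ n) + (1) * (((2:ℤ)) ^ p * ((5:ℤ)) ^ q * ((2:ℤ)) ^ r * ((2:ℤ)) ^ s * ((32:ℤ)) ^ n) + (-1) * (((2:ℤ)) ^ p * ((4:ℤ)) ^ q * ((1:ℤ)) ^ r * ((2:ℤ)) ^ s * ((16:ℤ)) ^ n) + (1) * (((2:ℤ)) ^ p * ((2:ℤ)) ^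 q * ((5:ℤ)) ^ r * ((2:ℤ)) ^ s * ((32:ℤ)) ^ n) + (-1) * (((2:ℤ)) ^ p * ((1:ℤ)) ^ q * ((4:ℤ)) ^ r * ((2:ℤ)) ^ s * ((16:ℤ)) ^ n) + (-1) * (((1:ℤ)) ^ p * ((2:ℤ)) ^ q * ((2:ℤ)) ^ r * ((1:ℤ)) ^ s * ((32:ℤ)) ^ n) + (1) * (((1:ℤ)) ^ p * ((1:ℤ)) ^ q * ((1:ℤ)) ^ r * ((1:ℤ)) ^ s * ((16:ℤ)) ^ n) := by
  unfold wmode ev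
  rw [Finset.sum_sub_distrib, Finset.sum_add_distrib]
  rw [cellsum_eq (some 2) (some 1) 2 0 ![some (0, 2), some (0, 3), none] g (by rw [hg]; decide)
      (fun σ hA => by rw [inMode_some2_mk_iff hA, hg, imp_hasW_iff (by decide)]; simp), hg, cell_M_closed_o1, cellsum_eq (some 2) (some 0) 2 1 ![some (1, 2), some (1, 3), none] g (by rw [hg]; decide)
      (fun σ hA => by rw [inMode_some2_mk_iff hA, hg, imp_hasW_iff (by decide)]; simp), hg, cell_M_closed_o2, cellsum_eq (some 2) none 0 1 ![some (0, 1), some (0, 2), some (0, 3), some (1, 2), some (1, 3), none] g (by rw [hg]; decide)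
      (fun σ hA => by rw [inMode_some2_mk_iff hA, hg, imp_hasW_iff (by decide)]; simp), hg, cell_M_closed_bad]
  ring

/-- The polynomial of the state `closed` of `c – x`. -/
def P_closed (p q r s n : ℕ) : ℤ := ((1) * (((4:ℤ)) ^ p * ((4:ℤ)) ^ q * ((4:ℤ)) ^ r * ((5:ℤ)) ^ s * ((16:ℤ)) ^ n) + (-1) * (((4:ℤ)) ^ p * ((2:ℤ)) ^ q * ((4:ℤ)) ^ r * ((3:ℤ)) ^ s * ((16:ℤ)) ^ n) + (1) * (((4:ℤ)) ^ p * ((4:ℤ)) ^ q * ((4:ℤ)) ^ r * ((5:ℤ)) ^ s * ((16:ℤ)) ^ n) + (-1) * (((4:ℤ)) ^ p * ((4:ℤ)) ^ q * ((2:ℤ)) ^ r * ((3:ℤ)) ^ s * ((16:ℤ)) ^ n) + (-1) * (((4:ℤ)) ^ p * ((4:ℤ)) ^ q * ((4:ℤ)) ^ r * ((5:ℤ)) ^ s * ((16:ℤ)) ^ n) + (1) * (((4:ℤ)) ^ p * ((4:ℤ)) ^ q * ((2:ℤ)) ^ r * ((3:ℤ)) ^ s * ((16:ℤ)) ^ n)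 + (1) * (((4:ℤ)) ^ p * ((2:ℤ)) ^ q * ((4:ℤ)) ^ r * ((3:ℤ)) ^ s * ((16:ℤ)) ^ n) + (-1) * (((4:ℤ)) ^ p * ((2:ℤ)) ^ q * ((2:ℤ)) ^ r * ((2:ℤ)) ^ s * ((16:ℤ)) ^ n)) + ((1) * (((5:ℤ)) ^ p * ((5:ℤ)) ^ q * ((4:ℤ)) ^ r * ((6:ℤ)) ^ s * ((16:ℤ)) ^ n) + (-1) * (((4:ℤ)) ^ p * ((4:ℤ)) ^ q * ((4:ℤ)) ^ r * ((5:ℤ)) ^ s * ((16:ℤ)) ^ n) + (1) * (((5:ℤ)) ^ p * ((5:ℤ)) ^ q * ((4:ℤ)) ^ r * ((6:ℤ)) ^ s * ((16:ℤ)) ^ n) + (-1) * (((4:ℤ)) ^ p * ((4:ℤ)) ^ q * ((4:ℤ)) ^ r * ((5:ℤ)) ^ s * ((16:ℤ)) ^ n) + (-1) * (((5:ℤ)) ^ p * ((5:ℤ)) ^ q * ((3:ℤ)) ^ r * ((5:ℤ)) ^ s * ((16:ℤ)) ^ n) + (1) * (((4:ℤ)) ^ p * ((4:ℤ)) ^ q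 * ((3:ℤ)) ^ r * ((4:ℤ)) ^ s * ((16:ℤ)) ^ n) + (-1) * (((5:ℤ)) ^ p * ((5:ℤ)) ^ q * ((4:ℤ)) ^ r * ((6:ℤ)) ^ s * ((16:ℤ)) ^ n) + (1) * (((4:ℤ)) ^ p * ((4:ℤ)) ^ q * ((4:ℤ)) ^ r * ((5:ℤ)) ^ s * ((16:ℤ)) ^ n) + (1) * (((5:ℤ)) ^ p * ((5:ℤ)) ^ q * ((2:ℤ)) ^ r * ((4:ℤ)) ^ s * ((16:ℤ)) ^ n) + (-1) * (((4:ℤ)) ^ p * ((4:ℤ)) ^ q * ((2:ℤ)) ^ r * ((3:ℤ)) ^ s * ((16:ℤ)) ^ n)) + ((1) * (((5:ℤ)) ^ p * ((4:ℤ)) ^ q * ((5:ℤ)) ^ r * ((6:ℤ)) ^ s * ((16:ℤ)) ^ n) + (-1) * (((4:ℤ)) ^ p * ((4:ℤ)) ^ q * ((4:ℤ)) ^ r * ((5:ℤ)) ^ s * ((16:ℤ)) ^ n) + (-1) * (((5:ℤ)) ^ p * ((3:ℤ)) ^ q * ((5:ℤ)) ^ r * ((5:ℤ)) ^ s * ((16:ℤ))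 ^ n) + (1) * (((4:ℤ)) ^ p * ((3:ℤ)) ^ q * ((4:ℤ)) ^ r * ((4:ℤ)) ^ s * ((16:ℤ)) ^ n) + (1) * (((5:ℤ)) ^ p * ((4:ℤ)) ^ q * ((5:ℤ)) ^ r * ((6:ℤ)) ^ s * ((16:ℤ)) ^ n) + (-1) * (((4:ℤ)) ^ p * ((4:ℤ)) ^ q * ((4:ℤ)) ^ r * ((5:ℤ)) ^ s * ((16:ℤ)) ^ n) + (-1) * (((5:ℤ)) ^ p * ((4:ℤ)) ^ q * ((5:ℤ)) ^ r * ((6:ℤ)) ^ s * ((16:ℤ)) ^ n) + (1) * (((4:ℤ)) ^ p * ((4:ℤ)) ^ q * ((4:ℤ)) ^ r * ((5:ℤ)) ^ s * ((16:ℤ)) ^ n) + (1) * (((5:ℤ)) ^ p * ((2:ℤ)) ^ q * ((5:ℤ)) ^ r * ((4:ℤ)) ^ s * ((16:ℤ)) ^ n) + (-1) * (((4:ℤ)) ^ p * ((2:ℤ)) ^ q * ((4:ℤ)) ^ r * ((3:ℤ)) ^ s * ((16:ℤ)) ^ n)) + ((1) * (((4:ℤ)) ^ p * ((5:ℤ))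 ^ q * ((5:ℤ)) ^ r * ((6:ℤ)) ^ s * ((32:ℤ)) ^ n) + (-1) * (((4:ℤ)) ^ p * ((4:ℤ)) ^ q * ((4:ℤ)) ^ r * ((5:ℤ)) ^ s * ((16:ℤ)) ^ n) + (-1) * (((3:ℤ)) ^ p * ((2:ℤ)) ^ q * ((5:ℤ)) ^ r * ((3:ℤ)) ^ s * ((32:ℤ)) ^ n) + (1) * (((3:ℤ)) ^ p * ((1:ℤ)) ^ q * ((4:ℤ)) ^ r * ((2:ℤ)) ^ s * ((16:ℤ)) ^ n) + (1) * (((4:ℤ)) ^ p * ((5:ℤ)) ^ q * ((5:ℤ)) ^ r * ((6:ℤ)) ^ s * ((32:ℤ)) ^ n) + (-1) * (((4:ℤ)) ^ p * ((4:ℤ)) ^ q * ((4:ℤ)) ^ r * ((5:ℤ)) ^ s * ((16:ℤ)) ^ n) + (-1) * (((3:ℤ)) ^ p * ((5:ℤ)) ^ q * ((2:ℤ)) ^ r * ((3:ℤ)) ^ s * ((32:ℤ)) ^ n) + (1) * (((3:ℤ)) ^ p * ((4:ℤ)) ^ q * ((1:ℤ)) ^ r * ((2:ℤ)) ^ s *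 ((16:ℤ)) ^ n) + (-1) * (((4:ℤ)) ^ p * ((5:ℤ)) ^ q * ((5:ℤ)) ^ r * ((6:ℤ)) ^ s * ((32:ℤ)) ^ n) + (1) * (((4:ℤ)) ^ p * ((4:ℤ)) ^ q * ((4:ℤ)) ^ r * ((5:ℤ)) ^ s * ((16:ℤ)) ^ n) + (1) * (((2:ℤ)) ^ p * ((5:ℤ)) ^ q * ((2:ℤ)) ^ r * ((2:ℤ)) ^ s * ((32:ℤ)) ^ n) + (-1) * (((2:ℤ)) ^ p * ((4:ℤ)) ^ q * ((1:ℤ)) ^ r * ((2:ℤ)) ^ s * ((16:ℤ)) ^ n) + (1) * (((2:ℤ)) ^ p * ((2:ℤ)) ^ q * ((5:ℤ)) ^ r * ((2:ℤ)) ^ s * ((32:ℤ)) ^ n) + (-1) * (((2:ℤ)) ^ p * ((1:ℤ)) ^ q * ((4:ℤ)) ^ r * ((2:ℤ)) ^ s * ((16:ℤ)) ^ n) + (-1) * (((1:ℤ)) ^ p * ((2:ℤ)) ^ q * ((2:ℤ)) ^ r * ((1:ℤ)) ^ s * ((32:ℤ)) ^ n) + (1) * (((1:ℤ)) ^ p *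 ((1:ℤ)) ^ q * ((1:ℤ)) ^ r * ((1:ℤ)) ^ s * ((16:ℤ)) ^ n))

/-- The sum of the weight over all branch configurations, `c – x` closed. -/
theorem sumg_closed (p q r s n : ℕ) (g : Fin 1 → Bool) (hg : cxbit g = false) :
    ∑ σ : BrConfig p q r s n, w (mk g σ) = P_closed p q r s n := by
  rw [sum_w_mk, Fintype.sum_option, Fin.sum_univ_three, part_R_closed p q r s n g hg, part_K_closed p q r s n g hg, part_L_closed p q r s n g hg, part_M_closed p q r s n g hg]
  unfold P_closed
  ring

/-- Mode R is impossible with `c – x` open. -/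
theorem part_R_open (p q r s n : ℕ) (g : Fin 1 → Bool) (hg : cxbit g = true) :
    ∑ σ ∈ univ.filter (allowed none : BrConfig p q r s n → Prop), wmode none (mk g σ) = 0 := by
  unfold wmode ev
  rw [Finset.sum_sub_distrib, Finset.sum_add_distrib]
  rw [cellsum_eq_zero_of_open (by decide) (some 1) 2 0 g hg, cellsum_eq_zero_of_open (by decide) (some 0) 2 1 g hg,
    cellsum_eq_zero_of_open (by decide) none 0 1 g hg]
  norm_num

/-- Mode K is impossible with `c – x` open. -/
theorem part_K_open (p q r s n : ℕ) (g : Fin 1 → Bool) (hg : cxbit g = true) :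
    ∑ σ ∈ univ.filter (allowed (some 0) : BrConfig p q r s n → Prop), wmode (some 0) (mk g σ) = 0 := by
  unfold wmode ev
  rw [Finset.sum_sub_distrib, Finset.sum_add_distrib]
  rw [cellsum_eq_zero_of_open (by decide) (some 1) 2 0 g hg, cellsum_eq_zero_of_open (by decide) (some 0) 2 1 g hg,
    cellsum_eq_zero_of_open (by decide) none 0 1 g hg]
  norm_num

/-- Mode L is impossible with `c – x` open. -/
theorem part_L_open (p q r s n : ℕ) (g : Fin 1 → Bool) (hg : cxbit g = true) :
    ∑ σ ∈ univ.filter (allowed (some 1) : BrConfig p q r s n → Prop), wmode (some 1) (mk g σ) = 0 := by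
  unfold wmode ev
  rw [Finset.sum_sub_distrib, Finset.sum_add_distrib]
  rw [cellsum_eq_zero_of_open (by decide) (some 1) 2 0 g hg, cellsum_eq_zero_of_open (by decide) (some 0) 2 1 g hg,
    cellsum_eq_zero_of_open (by decide) none 0 1 g hg]
  norm_num

/-- Mode M with `c – x` open: the three cells. -/
theorem part_M_open (p q r s n : ℕ) (g : Fin 1 → Bool) (hg : cxbit g = true) :
    ∑ σ ∈ univ.filter (allowed (some 2) : BrConfig p q r s n → Prop), wmode (some 2) (mk g σ) =
      (1) * (((4:ℤ)) ^ p * ((5:ℤ)) ^ q * ((5:ℤ)) ^ r * ((6:ℤ)) ^ s * ((32:ℤ)) ^ n) + (-1) * (((4:ℤ)) ^ p * ((2:ℤ)) ^ q * ((4:ℤ)) ^ r * ((3:ℤ)) ^ s * ((16:ℤ)) ^ n) + (-1) * (((3:ℤ)) ^ p * ((2:ℤ)) ^ q * ((5:ℤ)) ^ r * ((3:ℤ)) ^ s * ((32:ℤ)) ^ n) + (1) * (((3:ℤ)) ^ p * ((1:ℤ)) ^ q * ((4:ℤ)) ^ r * ((2:ℤ)) ^ s * ((16:ℤ)) ^ n)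 + (1) * (((4:ℤ)) ^ p * ((5:ℤ)) ^ q * ((5:ℤ)) ^ r * ((6:ℤ)) ^ s * ((32:ℤ)) ^ n) + (-1) * (((4:ℤ)) ^ p * ((4:ℤ)) ^ q * ((2:ℤ)) ^ r * ((3:ℤ)) ^ s * ((16:ℤ)) ^ n) + (-1) * (((3:ℤ)) ^ p * ((5:ℤ)) ^ q * ((2:ℤ)) ^ r * ((3:ℤ)) ^ s * ((32:ℤ)) ^ n) + (1) * (((3:ℤ)) ^ p * ((4:ℤ)) ^ q * ((1:ℤ)) ^ r * ((2:ℤ)) ^ s * ((16:ℤ)) ^ n) + (-1) * (((4:ℤ)) ^ p * ((5:ℤ)) ^ q * ((5:ℤ)) ^ r * ((6:ℤ)) ^ s * ((32:ℤ)) ^ n) + (1) * (((2:ℤ)) ^ p * ((5:ℤ)) ^ q * ((2:ℤ)) ^ r * ((2:ℤ)) ^ s * ((32:ℤ)) ^ n) + (1) * (((2:ℤ)) ^ p * ((2:ℤ)) ^ q * ((2:ℤ)) ^ r * ((0:ℤ)) ^ s * ((16:ℤ)) ^ n) + (-1) * (((1:ℤ)) ^ p * ((2:ℤ)) ^ q *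 ((1:ℤ)) ^ r * ((0:ℤ)) ^ s * ((16:ℤ)) ^ n) + (1) * (((2:ℤ)) ^ p * ((2:ℤ)) ^ q * ((2:ℤ)) ^ r * ((0:ℤ)) ^ s * ((16:ℤ)) ^ n) + (-1) * (((2:ℤ)) ^ p * ((2:ℤ)) ^ q * ((1:ℤ)) ^ r * ((0:ℤ)) ^ s * ((16:ℤ)) ^ n) + (1) * (((2:ℤ)) ^ p * ((2:ℤ)) ^ q * ((5:ℤ)) ^ r * ((2:ℤ)) ^ s * ((32:ℤ)) ^ n) + (-1) * (((1:ℤ)) ^ p * ((1:ℤ)) ^ q * ((2:ℤ)) ^ r * ((0:ℤ)) ^ s * ((16:ℤ)) ^ n) + (-1) * (((2:ℤ)) ^ p * ((1:ℤ)) ^ q * ((2:ℤ)) ^ r * ((0:ℤ)) ^ s * ((16:ℤ)) ^ n) + (-1) * (((1:ℤ)) ^ p * ((2:ℤ)) ^ q * ((2:ℤ)) ^ r * ((1:ℤ)) ^ s * ((32:ℤ)) ^ n) + (2) * (((1:ℤ)) ^ p * ((1:ℤ)) ^ q * ((1:ℤ)) ^ r * ((0:ℤ)) ^ s * ((16:ℤ))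 ^ n) := by
  unfold wmode ev
  rw [Finset.sum_sub_distrib, Finset.sum_add_distrib]
  rw [cellsum_eq (some 2) (some 1) 2 0 ![some (0, 2), some (0, 3), some (2, 3)] g (by rw [hg]; decide)
      (fun σ hA => by rw [inMode_some2_mk_iff hA, hg, imp_not_hasW_iff (by decide)]; simp), hg, cell_M_open_o1, cellsum_eq (some 2) (some 0) 2 1 ![some (1, 2), some (1, 3), some (2, 3)] g (by rw [hg]; decide)
      (fun σ hA => by rw [inMode_some2_mk_iff hA, hg, imp_not_hasW_iff (by decide)]; simp), hg, cell_M_open_o2, cellsum_eq (some 2) none 0 1 ![some (0, 1), some (0, 2), some (0, 3), some (1, 2), some (1, 3), some (2, 3)] g (by rw [hg]; decide)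
      (fun σ hA => by rw [inMode_some2_mk_iff hA, hg, imp_not_hasW_iff (by decide)]; simp), hg, cell_M_open_bad]
  ring

/-- The polynomial of the state `open` of `c – x`. -/
def P_open (p q r s n : ℕ) : ℤ := ((1) * (((4:ℤ)) ^ p * ((5:ℤ)) ^ q * ((5:ℤ)) ^ r * ((6:ℤ)) ^ s * ((32:ℤ)) ^ n) + (-1) * (((4:ℤ)) ^ p * ((2:ℤ)) ^ q * ((4:ℤ)) ^ r * ((3:ℤ)) ^ s * ((16:ℤ)) ^ n) + (-1) * (((3:ℤ)) ^ p * ((2:ℤ)) ^ q * ((5:ℤ)) ^ r * ((3:ℤ)) ^ s * ((32:ℤ)) ^ n) + (1) * (((3:ℤ)) ^ p * ((1:ℤ)) ^ q * ((4:ℤ)) ^ r * ((2:ℤ)) ^ s * ((16:ℤ)) ^ n) + (1) * (((4:ℤ)) ^ p * ((5:ℤ)) ^ q * ((5:ℤ)) ^ r * ((6:ℤ)) ^ s * ((32:ℤ)) ^ n) + (-1) * (((4:ℤ)) ^ p * ((4:ℤ)) ^ q * ((2:ℤ)) ^ r * ((3:ℤ)) ^ s * ((16:ℤ)) ^ n)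 + (-1) * (((3:ℤ)) ^ p * ((5:ℤ)) ^ q * ((2:ℤ)) ^ r * ((3:ℤ)) ^ s * ((32:ℤ)) ^ n) + (1) * (((3:ℤ)) ^ p * ((4:ℤ)) ^ q * ((1:ℤ)) ^ r * ((2:ℤ)) ^ s * ((16:ℤ)) ^ n) + (-1) * (((4:ℤ)) ^ p * ((5:ℤ)) ^ q * ((5:ℤ)) ^ r * ((6:ℤ)) ^ s * ((32:ℤ)) ^ n) + (1) * (((2:ℤ)) ^ p * ((5:ℤ)) ^ q * ((2:ℤ)) ^ r * ((2:ℤ)) ^ s * ((32:ℤ)) ^ n) + (1) * (((2:ℤ)) ^ p * ((2:ℤ)) ^ q * ((2:ℤ)) ^ r * ((0:ℤ)) ^ s * ((16:ℤ)) ^ n) + (-1) * (((1:ℤ)) ^ p * ((2:ℤ)) ^ q * ((1:ℤ)) ^ r * ((0:ℤ)) ^ s * ((16:ℤ)) ^ n) + (1) * (((2:ℤ)) ^ p * ((2:ℤ)) ^ q * ((2:ℤ)) ^ r * ((0:ℤ)) ^ s * ((16:ℤ)) ^ n) + (-1) * (((2:ℤ)) ^ p * ((2:ℤ)) ^ q *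 ((1:ℤ)) ^ r * ((0:ℤ)) ^ s * ((16:ℤ)) ^ n) + (1) * (((2:ℤ)) ^ p * ((2:ℤ)) ^ q * ((5:ℤ)) ^ r * ((2:ℤ)) ^ s * ((32:ℤ)) ^ n) + (-1) * (((1:ℤ)) ^ p * ((1:ℤ)) ^ q * ((2:ℤ)) ^ r * ((0:ℤ)) ^ s * ((16:ℤ)) ^ n) + (-1) * (((2:ℤ)) ^ p * ((1:ℤ)) ^ q * ((2:ℤ)) ^ r * ((0:ℤ)) ^ s * ((16:ℤ)) ^ n) + (-1) * (((1:ℤ)) ^ p * ((2:ℤ)) ^ q * ((2:ℤ)) ^ r * ((1:ℤ)) ^ s * ((32:ℤ)) ^ n) + (2) * (((1:ℤ)) ^ p * ((1:ℤ)) ^ q * ((1:ℤ)) ^ r * ((0:ℤ)) ^ s * ((16:ℤ)) ^ n))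

/-- The sum of the weight over all branch configurations, `c – x` open. -/
theorem sumg_open (p q r s n : ℕ) (g : Fin 1 → Bool) (hg : cxbit g = true) :
    ∑ σ : BrConfig p q r s n, w (mk g σ) = P_open p q r s n := by
  rw [sum_w_mk, Fintype.sum_option, Fin.sum_univ_three, part_R_open p q r s n g hg, part_K_open p q r s n g hg, part_L_open p q r s n g hg, part_M_open p q r s n g hg]
  unfold P_open
  ring

/-! ### The theorem -/

/-- A sum over the configurations of the gadget is a double sum over the state of `c – x` and the
branch configuration. -/
theorem sum_config_eq_sum_mk (f : Config (PE p q r s n) → ℤ) :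
    ∑ ω : Config (PE p q r s n), f ω = ∑ g : Fin 1 → Bool, ∑ σ : BrConfig p q r s n, f (mk g σ) := by
  have h1 : ∑ ω : Config (PE p q r s n), f ω =
      ∑ x : (Fin 1 → Bool) × BrConfig p q r s n, f (mk x.1 x.2) :=
    Fintype.sum_equiv (Equiv.sumArrowEquivProdArrow (Fin 1)
      (Σ b : Br p q r s n, BrEdge' (brType b)) Bool) f (fun x => f (mk x.1 x.2)) fun ω => by
        unfold mk
        congr 1
        exact (Sum.elim_comp_inl_inr ω).symm
  rw [h1]
  exact Fintype.sum_prod_type' fun g σ => f (mk g σ)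

/-- The (★)-slack in the H-graph form, as the sum of the weights. -/
theorem cards_eq_sum_w :
    ((univ.filter fun ω : Config (PE p q r s n) =>
        (purePairGadget p q r s n).IsBot ω (vm 0) (vm 1) (vm 2) ∧
          (purePairGadget p q r s n).HConnAvoid ω (vm 2) ((purePairGadget p q r s n).cluster ω (vm 1))
            (vm 2) (vm 0)).card : ℤ) +
      ((univ.filter fun ω : Config (PE p q r s n) =>
        (purePairGadget p q r s n).IsBot ω (vm 0) (vm 1) (vm 2) ∧
          (purePairGadget p q r s n).HConnAvoid ω (vm 2) ((purePairGadget p q r s n).cluster ω (vm 0))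
            (vm 2) (vm 1)).card : ℤ) -
      ((univ.filter fun ω : Config (PE p q r s n) =>
        (purePairGadget p q r s n).IsBot ω (vm 0) (vm 1) (vm 2) ∧
          (purePairGadget p q r s n).HConn ω (vm 2) (vm 0) (vm 1)).card : ℤ) =
      ∑ ω : Config (PE p q r s n), w ω := by
  have c1 : (univ.filter fun ω : Config (PE p q r s n) =>
      (purePairGadget p q r s n).IsBot ω (vm 0) (vm 1) (vm 2) ∧
        (purePairGadget p q r s n).HConnAvoid ω (vm 2) ((purePairGadget p q r s n).cluster ω (vm 1))
          (vm 2) (vm 0)) =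
      univ.filter fun ω : Config (PE p q r s n) =>
        (purePairGadget p q r s n).IsBot ω (vm 0) (vm 1) (vm 2) ∧ ev (some 1) 2 0 ω :=
    Finset.filter_congr fun ω _ => Iff.rfl
  have c2 : (univ.filter fun ω : Config (PE p q r s n) =>
      (purePairGadget p q r s n).IsBot ω (vm 0) (vm 1) (vm 2) ∧
        (purePairGadget p q r s n).HConnAvoid ω (vm 2) ((purePairGadget p q r s n).cluster ω (vm 0))
          (vm 2) (vm 1)) =
      univ.filter fun ω : Config (PE p q r s n) =>
        (purePairGadget p q r s n).IsBot ω (vm 0) (vm 1) (vm 2) ∧ ev (some 0) 2 1 ω :=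
    Finset.filter_congr fun ω _ => Iff.rfl
  have c3 : (univ.filter fun ω : Config (PE p q r s n) =>
      (purePairGadget p q r s n).IsBot ω (vm 0) (vm 1) (vm 2) ∧
        (purePairGadget p q r s n).HConn ω (vm 2) (vm 0) (vm 1)) =
      univ.filter fun ω : Config (PE p q r s n) =>
        (purePairGadget p q r s n).IsBot ω (vm 0) (vm 1) (vm 2) ∧ ev none 0 1 ω :=
    Finset.filter_congr fun ω _ => and_congr_right fun _ => hConn_iff_hConnAvoid_empty ω _ _
  unfold w
  rw [Finset.sum_sub_distrib, Finset.sum_add_distrib, Finset.sum_boole, Finset.sum_boole,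
    Finset.sum_boole, c1, c2, c3]

/-- **The graph half of the pure-pair theorem**: the (★)-slack of `x ~ c` + hubs + pure pairs
is `G`. -/
theorem purePair_delta (p q r s n : ℕ) :
    ((univ.filter fun ω : Config (PE p q r s n) =>
        (purePairGadget p q r s n).IsBot ω (vm 0) (vm 1) (vm 2) ∧
          (purePairGadget p q r s n).HConnAvoid ω (vm 2) ((purePairGadget p q r s n).cluster ω (vm 1))
            (vm 2) (vm 0)).card : ℤ) +
      ((univ.filter fun ω : Config (PE p q r s n) =>
        (purePairGadget p q r s n).IsBot ω (vm 0) (vm 1) (vm 2) ∧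
          (purePairGadget p q r s n).HConnAvoid ω (vm 2) ((purePairGadget p q r s n).cluster ω (vm 0))
            (vm 2) (vm 1)).card : ℤ) -
      ((univ.filter fun ω : Config (PE p q r s n) =>
        (purePairGadget p q r s n).IsBot ω (vm 0) (vm 1) (vm 2) ∧
          (purePairGadget p q r s n).HConn ω (vm 2) (vm 0) (vm 1)).card : ℤ) =
      StarGadget.G p q r s n := by
  rw [cards_eq_sum_w, sum_config_eq_sum_mk]
  rw [sum_fun_fin_le_one 1 (by decide) _ (P_closed p q r s n) (P_open p q r s n)
    (fun g hg => sumg_closed p q r s n g hg) (fun g hg => sumg_open p q r s n g hg)]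
  rw [if_pos rfl]
  unfold P_closed P_open StarGadget.G
  ring

/-- **The pure-pair theorem**: the D-free inequality holds on `x ~ c` + hubs + pure pairs. -/
theorem purePair_dFreeIneq (p q r s n : ℕ) :
    (purePairGadget p q r s n).DFreeIneq (vm 0) (vm 1) (vm 2) := by
  rw [dFreeIneq_iff_hGraph]
  have h := purePair_delta p q r s n
  have hG := StarGadget.G_nonneg p q r s n
  rw [← h] at hG
  have key : ((univ.filter fun ω : Config (PE p q r s n) =>
      (purePairGadget p q r s n).IsBot ω (vm 0) (vm 1) (vm 2) ∧
        (purePairGadget p q r s n).HConn ω (vm 2) (vm 0) (vm 1)).card : ℤ) ≤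
      ((univ.filter fun ω : Config (PE p q r s n) =>
        (purePairGadget p q r s n).IsBot ω (vm 0) (vm 1) (vm 2) ∧
          (purePairGadget p q r s n).HConnAvoid ω (vm 2) ((purePairGadget p q r s n).cluster ω (vm 1))
            (vm 2) (vm 0)).card : ℤ) +
        ((univ.filter fun ω : Config (PE p q r s n) =>
          (purePairGadget p q r s n).IsBot ω (vm 0) (vm 1) (vm 2) ∧
            (purePairGadget p q r s n).HConnAvoid ω (vm 2) ((purePairGadget p q r s n).cluster ω (vm 0))
              (vm 2) (vm 1)).card : ℤ) := by
    linarith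
  exact_mod_cast key

end PercRepro.PurePairGraph
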